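import Summits.CriticalPhenomena.SAWScalingLimit.Theses.SAWDefectDecoherence
import Summits.CriticalPhenomena.SAWScalingLimit.Theses.SAWDevelopingMap
import Summits.CriticalPhenomena.SAWScalingLimit.Theses.SAWLatticeVirasoro
import Summits.CriticalPhenomena.SAWScalingLimit.Theorems.SAWDefectDecoherenceObservableToSLERSLELawContinuity
import Summits.CriticalPhenomena.SAWScalingLimit.Theorems.SAWDefectDecoherenceObservableToSLERTwoPieceRestrictionLimit
import Summits.CriticalPhenomena.SAWScalingLimit.Theorems.SAWDefectDecoherenceObservableToSLERModulusOfSimpleLimits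
import Summits.CriticalPhenomena.SAWScalingLimit.Theorems.SAWDevelopingMapObservableToSLETypeLadderAssemblyR
import Summits.CriticalPhenomena.SAWScalingLimit.Theorems.SAWDevelopingMapObservableToSLETypeLadderCarvedReductionAssemblyP
import Summits.CriticalPhenomena.SAWScalingLimit.Theorems.SAWDefectDecoherenceObservableToSLERCoOrientedReductionSolid
import Summits.CriticalPhenomena.SAWScalingLimit.Theorems.SAWDefectDecoherenceObservableToSLERResidueAssembly
import Summits.CriticalPhenomena.SAWScalingLimit.Theorems.SAWDevelopingMapObservableToSLETypeLadderTwoPieceAdmIdentification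
import HarnessLib

/-!
# Crux `SAWDefectDecoherence.ObservableToSLER` (stmt-CriticalPhenomena-14005), line `bridge-gate-renewal`
(skeleton r11): THE RESIDUE ASSEMBLY, FAT-SPINE FORM — the crux from its three research inputs and the solid squeeze

Landing target:
`Summits/CriticalPhenomena/SAWScalingLimit/Theorems/SAWDefectDecoherenceObservableToSLERResidueAssemblySolid.lean`
(`--supports stmt-CriticalPhenomena-14005`; continuation lead prover-line-stmt-CriticalPhenomena-14005-c3-0;
registered sub-goal `stub_residueSolid_modulus`).

`observableToSLER_of_residueSolid` — **the crux CLOSED MODULO ITS r11 RESIDUE**, kernel-checked: from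
(2ʀ) nested renewal with fat co-oriented SOLID families, locality scale bounded (registered stub
`stub_nestedRenewalFatCoSolidR`, verbatim), (5a1) two-piece source locality (registered stub
`stub_twoPieceSourceLocality`, verbatim), (5mₐ) the EXISTING shared item stmt-CriticalPhenomena-7148
`SAWLatticeVirasoro.HexSimpleSubseqLimits` (by name), and (5a4″) the solid moving-carving squeeze from the two-piece
admissible restriction limit (registered stub `stub_carvedReduction_squeezeSolid`, verbatim — provable soft geometry,
in flight on both cruxes), the crux follows.  Proof = the r11 skeleton's composition over landed theorems only: ARL″
`TwoPiece.stub_twoPieceAdmRestrictionLimit` (p121515); T2a `TypeLadder.stub_twoPieceAdmIdentification` (p126992); the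
generic carved-reduction assembly `TypeLadder.stub_carvedReduction_assemblyP` (p130700) with
`BridgeGate.stub_sleLawContinuity` (p81676); the solid co-oriented reduction `CoOrientedSolid.stub_coOrientedReductionSolid`
(p134331); the sequential reduction `NestedGate.stub_seqReductionPM` (p120538) with `stub_midTightN` (p116996) and
`stub_midModulusN` (p120791) fed by `Modulus.stub_hexUniformModulus_of_simpleLimits` (p127640); the R-bounded nested
transfer `TypeLadder.stub_nestedTransferPR` (p124665) with `BridgeGate.stub_gateDecomposition` (p82259); and
`Negative.convergesInLawToSLE_of_identification`.  Companion of `…ResidueAssembly.lean` (p129881, r9 form).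
So when 5a4″ lands, `observableToSLER_of_residueSolid h2 h5a1 h7148 stub_carvedReduction_squeezeSolid` leaves exactly the
three research-grade lattice inputs {abundance 2ʀ, anchor 5a1, simple subsequential limits 7148}.
-/

noncomputable section

open scoped BigOperators Topology NNReal ENNReal Classical BoundedContinuousFunction
open Filter Set MeasureTheory Metric
open Literature.Probability.LatticeModels (HexVertex hexGraph hexCenter triZeta Site polyline)
open Literature.Probability.RandomPlanarGeometry
open Literature.Probability.RandomPlanarGeometry.SAW
open UpperHalfPlane (upperHalfPlaneSet)

namespace Summit.CriticalPhenomena.SAWScalingLimit.Theorems.ObservableToSLER.Residue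

open Summit.CriticalPhenomena.SAWScalingLimit.Theses.SAWDefectDecoherence (HexObservableLimitR HexTight ObservableToSLER)
open Summit.CriticalPhenomena.SAWScalingLimit.Theorems.ObservableToSLER.BridgeGate
open Summit.CriticalPhenomena.SAWScalingLimit.Theorems.ObservableToSLER.NestedGate

/-- **Registered sub-goal `stub_residueSolid_modulus`** — the modulus input of the line from the crux's own hypothesis
`HexTight` and the shared item stmt-CriticalPhenomena-7148 (both by NAME): `HexTight → HexSimpleSubseqLimits →
HexUniformModulus`, a corollary of `Modulus.stub_hexUniformModulus_of_simpleLimits` (p127640). -/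
theorem stub_residueSolid_modulus :
    HexTight → Summit.CriticalPhenomena.SAWScalingLimit.Theses.SAWLatticeVirasoro.HexSimpleSubseqLimits →
    ∀ (D : DobrushinDomain) (a b : ℝ → HexVertex), IsEmbEndpointApprox hexGraph hexCenter D a b →
      ∀ ε > (0 : ℝ), ∀ η > (0 : ℝ), ∃ θ > (0 : ℝ), ∀ᶠ δ : ℝ in 𝓝[>] 0,
        hexSAWLaw D.carrier δ (a δ) (b δ) {γ | γ.curve ∉ CurveClass.modulusClass ε θ} ≤
          ENNReal.ofReal η :=
  fun hT h7148 =>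
    Summit.CriticalPhenomena.SAWScalingLimit.Theorems.ObservableToSLER.Modulus.stub_hexUniformModulus_of_simpleLimits
      hT h7148

/-- **THE RESIDUE ASSEMBLY, FAT-SPINE FORM.**  `ObservableToSLER` from: (2ʀ) nested renewal with fat co-oriented solid
tame families, locality scale bounded; (5a1) two-piece source locality; (5mₐ) simplicity of all subsequential limits
of the critical hexagonal SAW laws (item stmt-CriticalPhenomena-7148); (5a4″) the solid moving-carving squeeze from the
two-piece admissible restriction limit.  Hypotheses 1, 2, 4 are the registered stubs of skeleton r11 verbatim. -/
theorem observableToSLER_of_residueSolid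
    (h2 :
      ∀ (D : DobrushinDomain) (a b : ℝ → HexVertex), IsEmbEndpointApprox hexGraph hexCenter D a b →
        ∀ ε > (0 : ℝ), ∃ R₂ > (0 : ℝ), ∀ R ∈ Set.Ioc (0 : ℝ) R₂, ∃ ρ > (0 : ℝ), ∃ N : ℕ, ∀ᶠ δ : ℝ in 𝓝[>] 0,
          ∃ S T : ℕ → Set HexVertex,
            TameNestedFamily δ R N (a δ) S ∧ TameNestedFamily δ R N (b δ) T ∧
            ((∀ n, ExteriorAnchored D.carrier δ (S n) (a δ)) ∧
              (∀ n, ExteriorAnchored D.carrier δ (T n) (b δ)) ∧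
              ∃ j : Fin 6,
                ((∀ (n : ℕ) (p q : HexVertex), HasCleanWindow D.carrier δ ρ (S n) p q →
                    rowOf j q = rowOf j p + 1 ∧
                      ∀ x : HexVertex, (δ : ℂ) * hexCenter x ∈ ball ((δ : ℂ) * hexCenter q) ρ →
                        (x ∈ S n ↔ rowOf j x ≤ rowOf j p)) ∧
                  (∀ (n : ℕ) (p q : HexVertex), HasCleanWindow D.carrier δ ρ (T n) p q →
                    rowOf j q = rowOf j p + 1 ∧
                      ∀ x : HexVertex, (δ : ℂ) * hexCenter x ∈ ball ((δ : ℂ) * hexCenter q) ρ →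
                        (x ∈ T n ↔ rowOf j x ≤ rowOf j p))) ∧
                (∀ (n : ℕ) (p q : HexVertex), HasCleanWindow D.carrier δ ρ (S n) p q →
                  ∃ K : Set ℂ, IsCompact K ∧ IsConnected K ∧
                    (δ : ℂ) * hexCenter q - ((ρ / 2 : ℝ) : ℂ) * Complex.I * triZeta ^ (j : ℕ) ∈ K ∧
                    (δ : ℂ) * hexCenter (a δ) ∈ K ∧
                    ∀ v : HexVertex, Metric.infDist ((δ : ℂ) * hexCenter v) K ≤ ρ / 4 → v ∈ S n) ∧
                (∀ (n : ℕ) (p q : HexVertex), HasCleanWindow D.carrier δ ρ (T n) p q →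
                  ∃ K : Set ℂ, IsCompact K ∧ IsConnected K ∧
                    (δ : ℂ) * hexCenter q - ((ρ / 2 : ℝ) : ℂ) * Complex.I * triZeta ^ (j : ℕ) ∈ K ∧
                    (δ : ℂ) * hexCenter (b δ) ∈ K ∧
                    ∀ v : HexVertex, Metric.infDist ((δ : ℂ) * hexCenter v) K ≤ ρ / 4 → v ∈ T n) ∧
                (∀ n : ℕ, ∃ K : Set ℂ, IsCompact K ∧ IsConnected K ∧ (δ : ℂ) * hexCenter (a δ) ∈ K ∧
                  (∀ v : HexVertex, Metric.infDist ((δ : ℂ) * hexCenter v) K ≤ ρ / 8 → v ∈ S n) ∧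
                  (∀ v ∈ S n, ∃ (t w : HexVertex) (r : ℕ), v ∈ hexBall t r ∧ w ∈ hexBall t r ∧
                    hexBall t r ⊆ S n ∧ Metric.infDist ((δ : ℂ) * hexCenter w) K ≤ ρ / 16)) ∧
                (∀ n : ℕ, ∃ K : Set ℂ, IsCompact K ∧ IsConnected K ∧ (δ : ℂ) * hexCenter (b δ) ∈ K ∧
                  (∀ v : HexVertex, Metric.infDist ((δ : ℂ) * hexCenter v) K ≤ ρ / 8 → v ∈ T n) ∧
                  (∀ v ∈ T n, ∃ (t w : HexVertex) (r : ℕ), v ∈ hexBall t r ∧ w ∈ hexBall t r ∧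
                    hexBall t r ⊆ T n ∧ Metric.infDist ((δ : ℂ) * hexCenter w) K ≤ ρ / 16))) ∧
            hexSAWLaw D.carrier δ (a δ) (b δ)
                {γ | ¬ ∃ (n m : ℕ) (p q : HexVertex) (n' m' : ℕ) (p' q' : HexVertex),
                    IsFirstGoodGateN D.carrier δ ρ R S (a δ) γ.walk.support n m p q ∧
                    IsFirstGoodGateN D.carrier δ ρ R T (b δ) γ.walk.support.reverse n' m' p' q' ∧
                    WideLink D.carrier δ ρ (S n ∪ T n') q q'} ≤
              ENNReal.ofReal ε)
    (h5a1 :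
      ∀ (E : DobrushinDomain) (ρ : ℝ) (Λ : ℝ → Finset HexVertex) (m₀ : ℝ → ℤ)
        (a : ℝ → Sym2 HexVertex),
        0 < ρ → E.carrier ∩ ball (E.pt 0) ρ = {z : ℂ | (E.pt 0).im < z.im} ∩ ball (E.pt 0) ρ →
        (∀ᶠ δ : ℝ in 𝓝[>] 0, hexDomainSimplyConnected (Λ δ) ∧ a δ ∈ hexDomainBoundary (Λ δ) ∧
          (∀ v ∈ Λ δ, (δ : ℂ) * hexCenter v ∈ E.carrier) ∧
          (∀ v : HexVertex, (δ : ℂ) * hexCenter v ∈ ball (E.pt 0) ρ → (v ∈ Λ δ ↔ m₀ δ ≤ v.1 1))) →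
        Tendsto (fun δ : ℝ => (δ : ℂ) * hexMidpoint (a δ)) (𝓝[>] 0) (𝓝 (E.pt 0)) →
        ∀ ε : ℝ, 0 < ε → ∃ K : ℝ, 0 < K ∧ ∃ t₀ : ℝ, 0 < t₀ ∧
          ∀ (s : ℝ → Sym2 HexVertex) (t : ℝ), t ≠ 0 → |t| < t₀ →
            (∀ᶠ δ : ℝ in 𝓝[>] 0, s δ ∈ hexDomainBoundary (Λ δ) ∧
              (hexMidpoint (s δ)).im = (hexMidpoint (a δ)).im) →
            Tendsto (fun δ : ℝ => (δ : ℂ) * hexMidpoint (s δ)) (𝓝[>] 0) (𝓝 (E.pt 0 + t)) →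
            ∀ᶠ δ : ℝ in 𝓝[>] 0,
              (∑ γ : HexMidEdgeSAW (Λ δ) (a δ) (s δ),
                  if ∃ v ∈ γ.verts, K * |t| ≤ dist ((δ : ℂ) * hexCenter v) ((δ : ℂ) * hexMidpoint (a δ))
                  then hexCriticalFugacity ^ γ.length else 0) ≤
                ε * ∑ γ : HexMidEdgeSAW (Λ δ) (a δ) (s δ), hexCriticalFugacity ^ γ.length)
    (h7148 : Summit.CriticalPhenomena.SAWScalingLimit.Theses.SAWLatticeVirasoro.HexSimpleSubseqLimits)
    (hSq :
      (∀ (D D' : DobrushinDomain) (ρ : ℝ) (φ : ConformalEquiv upperHalfPlaneSet D.carrier)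
        (Φ : ConformalEquiv (upperHalfPlaneSet \ φ.pullbackHull D') upperHalfPlaneSet) (d : ℝ)
        (Λ Λ' : ℝ → Finset HexVertex) (m₀ m₁ m₁' : ℝ → ℤ) (a b : ℝ → Sym2 HexVertex),
        (0 < ρ ∧ ∀ i : Fin 2, D.carrier ∩ ball (D.pt i) ρ = {z : ℂ | (D.pt i).im < z.im} ∩ ball (D.pt i) ρ) →
        D.IsHullSubdomain D' → D.IsChordalUniformizing φ →
        IsRestrictionMap (φ.pullbackHull D') Φ → HasRestrictionDeriv (φ.pullbackHull D') Φ d →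
        (∀ᶠ δ : ℝ in 𝓝[>] 0,
          Λ' δ ⊆ Λ δ ∧ hexDomainSimplyConnected (Λ δ) ∧ hexDomainSimplyConnected (Λ' δ) ∧
          (hexGraph.induce (↑(Λ δ) : Set HexVertex)).Preconnected ∧
          (hexGraph.induce (↑(Λ' δ) : Set HexVertex)).Preconnected ∧
          a δ ∈ hexDomainBoundary (Λ δ) ∧ b δ ∈ hexDomainBoundary (Λ δ) ∧
          a δ ∈ hexDomainBoundary (Λ' δ) ∧ b δ ∈ hexDomainBoundary (Λ' δ) ∧
          Nonempty (HexMidEdgeSAW (Λ' δ) (a δ) (b δ)) ∧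
          (∀ v ∈ Λ δ, (δ : ℂ) * hexCenter v ∈ D.carrier) ∧
          (∀ v ∈ Λ' δ, (δ : ℂ) * hexCenter v ∈ D'.carrier) ∧
          (∀ v : HexVertex, (δ : ℂ) * hexCenter v ∈ ball (D.pt 0) ρ →
            ((v ∈ Λ δ ↔ m₀ δ ≤ v.1 1) ∧ (v ∈ Λ' δ ↔ m₀ δ ≤ v.1 1))) ∧
          (∀ v : HexVertex, (δ : ℂ) * hexCenter v ∈ ball (D.pt 1) ρ →
            ((v ∈ Λ δ ↔ m₁ δ ≤ v.1 1) ∧ (v ∈ Λ' δ ↔ m₁' δ ≤ v.1 1)))) →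
        (∀ K : Set ℂ, IsCompact K → K ⊆ D.carrier →
          ∀ᶠ δ : ℝ in 𝓝[>] 0, ∀ v : HexVertex, (δ : ℂ) * hexCenter v ∈ K → v ∈ Λ δ) →
        (∀ K : Set ℂ, IsCompact K → K ⊆ D'.carrier →
          ∀ᶠ δ : ℝ in 𝓝[>] 0, ∀ v : HexVertex, (δ : ℂ) * hexCenter v ∈ K → v ∈ Λ' δ) →
        Tendsto (fun δ : ℝ => (δ : ℂ) * hexMidpoint (a δ)) (𝓝[>] 0) (𝓝 (D.pt 0)) →
        Tendsto (fun δ : ℝ => (δ : ℂ) * hexMidpoint (b δ)) (𝓝[>] 0) (𝓝 (D.pt 1)) →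
        Tendsto (fun δ : ℝ =>
            (∑ γ : HexMidEdgeSAW (Λ' δ) (a δ) (b δ), hexCriticalFugacity ^ γ.length) /
              (∑ γ : HexMidEdgeSAW (Λ δ) (a δ) (b δ), hexCriticalFugacity ^ γ.length)) (𝓝[>] 0)
          (𝓝 (d ^ ((5 : ℝ) / 8)))) →
      (∀ (D : DobrushinDomain) (a b : ℝ → HexVertex), IsEmbEndpointApprox hexGraph hexCenter D a b →
        ∀ η > (0 : ℝ), ∃ R₀ > (0 : ℝ), ∀ R ∈ Set.Ioc (0 : ℝ) R₀, ∀ ρ > (0 : ℝ), ∀ N : ℕ,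
            ∀ (δ : ℕ → ℝ) (S T : ℕ → ℕ → Set HexVertex) (n n' : ℕ → ℕ) (q q' : ℕ → HexVertex),
              Tendsto δ atTop (𝓝[>] 0) →
              (∀ k, TameNestedFamily (δ k) R N (a (δ k)) (S k) ∧
                TameNestedFamily (δ k) R N (b (δ k)) (T k) ∧
                (((∀ i, ExteriorAnchored D.carrier (δ k) (S k i) (a (δ k))) ∧
            (∀ i, ExteriorAnchored D.carrier (δ k) (T k i) (b (δ k))) ∧
            (∀ (i : ℕ) (p q : HexVertex), HasCleanWindow D.carrier (δ k) ρ (S k i) p q →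
              rowOf 0 q = rowOf 0 p + 1 ∧
                ∀ x : HexVertex, ((δ k : ℝ) : ℂ) * hexCenter x ∈ ball (((δ k : ℝ) : ℂ) * hexCenter q) ρ →
                  (x ∈ S k i ↔ rowOf 0 x ≤ rowOf 0 p)) ∧
            (∀ (i : ℕ) (p q : HexVertex), HasCleanWindow D.carrier (δ k) ρ (T k i) p q →
              rowOf 0 q = rowOf 0 p + 1 ∧
                ∀ x : HexVertex, ((δ k : ℝ) : ℂ) * hexCenter x ∈ ball (((δ k : ℝ) : ℂ) * hexCenter q) ρ →
                  (x ∈ T k i ↔ rowOf 0 x ≤ rowOf 0 p))) ∧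
            (∀ (i : ℕ) (p q : HexVertex), HasCleanWindow D.carrier (δ k) ρ (S k i) p q →
              ∃ K : Set ℂ, IsCompact K ∧ IsConnected K ∧
                ((δ k : ℝ) : ℂ) * hexCenter q - ((ρ / 2 : ℝ) : ℂ) * Complex.I ∈ K ∧ ((δ k : ℝ) : ℂ) * hexCenter (a (δ k)) ∈ K ∧
                ∀ v : HexVertex, Metric.infDist (((δ k : ℝ) : ℂ) * hexCenter v) K ≤ ρ / 4 → v ∈ S k i) ∧
            (∀ (i : ℕ) (p q : HexVertex), HasCleanWindow D.carrier (δ k) ρ (T k i) p q →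
              ∃ K : Set ℂ, IsCompact K ∧ IsConnected K ∧
                ((δ k : ℝ) : ℂ) * hexCenter q - ((ρ / 2 : ℝ) : ℂ) * Complex.I ∈ K ∧ ((δ k : ℝ) : ℂ) * hexCenter (b (δ k)) ∈ K ∧
                ∀ v : HexVertex, Metric.infDist (((δ k : ℝ) : ℂ) * hexCenter v) K ≤ ρ / 4 → v ∈ T k i) ∧
            (∀ i : ℕ, ∃ K : Set ℂ, IsCompact K ∧ IsConnected K ∧ ((δ k : ℝ) : ℂ) * hexCenter (a (δ k)) ∈ K ∧
              (∀ v : HexVertex, Metric.infDist (((δ k : ℝ) : ℂ) * hexCenter v) K ≤ ρ / 8 → v ∈ S k i) ∧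
              (∀ v ∈ S k i, ∃ (t w : HexVertex) (r : ℕ), v ∈ hexBall t r ∧ w ∈ hexBall t r ∧
                hexBall t r ⊆ S k i ∧ Metric.infDist (((δ k : ℝ) : ℂ) * hexCenter w) K ≤ ρ / 16)) ∧
            (∀ i : ℕ, ∃ K : Set ℂ, IsCompact K ∧ IsConnected K ∧ ((δ k : ℝ) : ℂ) * hexCenter (b (δ k)) ∈ K ∧
              (∀ v : HexVertex, Metric.infDist (((δ k : ℝ) : ℂ) * hexCenter v) K ≤ ρ / 8 → v ∈ T k i) ∧
              (∀ v ∈ T k i, ∃ (t w : HexVertex) (r : ℕ), v ∈ hexBall t r ∧ w ∈ hexBall t r ∧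
                hexBall t r ⊆ T k i ∧ Metric.infDist (((δ k : ℝ) : ℂ) * hexCenter w) K ≤ ρ / 16)))) →
              (∀ k, ∃ (γ : HexDomainSAW D.carrier (δ k) (a (δ k)) (b (δ k))) (m : ℕ) (p : HexVertex)
                  (m' : ℕ) (p' : HexVertex),
                IsFirstGoodGateN D.carrier (δ k) ρ R (S k) (a (δ k)) γ.walk.support (n k) m p (q k) ∧
                IsFirstGoodGateN D.carrier (δ k) ρ R (T k) (b (δ k)) γ.walk.support.reverse
                  (n' k) m' p' (q' k) ∧
                WideLink D.carrier (δ k) ρ (S k (n k) ∪ T k (n' k)) (q k) (q' k)) →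
              ∀ ε' > (0 : ℝ), ∀ φ : ℕ → ℕ, StrictMono φ →
                ∃ (ψ : ℕ → ℕ) (M : DobrushinDomain) (τ : ℂ) (ρ' : ℝ) (Λ' : ℝ → Finset HexVertex)
                  (m : Fin 2 → ℝ → ℤ) (a' b' : ℝ → Sym2 HexVertex) (x : ℕ → Site 2)
                  (Λ'' : ℕ → Finset HexVertex) (pu pv : ℕ → HexVertex),
                  StrictMono ψ ∧
                  (∀ t : ℝ, dist (M.boundary t + τ) (D.boundary t) ≤ η) ∧
                  dist (M.pt 0 + τ) (D.pt 0) ≤ η ∧ dist (M.pt 1 + τ) (D.pt 1) ≤ η ∧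
                  (0 < ρ' ∧ ∀ i : Fin 2,
                    M.carrier ∩ ball (M.pt i) ρ' = {z : ℂ | (M.pt i).im < z.im} ∩ ball (M.pt i) ρ') ∧
                  (∀ᶠ δ' : ℝ in 𝓝[>] 0, hexDomainSimplyConnected (Λ' δ') ∧
                    a' δ' ∈ hexDomainBoundary (Λ' δ') ∧ b' δ' ∈ hexDomainBoundary (Λ' δ') ∧
                    Nonempty (HexMidEdgeSAW (Λ' δ') (a' δ') (b' δ')) ∧
                    (hexGraph.induce (↑(Λ' δ') : Set HexVertex)).Preconnected ∧
                    (∀ v ∈ Λ' δ', (δ' : ℂ) * hexCenter v ∈ M.carrier) ∧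
                    (∀ i : Fin 2, ∀ v : HexVertex, (δ' : ℂ) * hexCenter v ∈ ball (M.pt i) ρ' →
                      (v ∈ Λ' δ' ↔ m i δ' ≤ v.1 1))) ∧
                  (∀ K : Set ℂ, IsCompact K → K ⊆ M.carrier →
                    ∀ᶠ δ' : ℝ in 𝓝[>] 0, ∀ v : HexVertex, (δ' : ℂ) * hexCenter v ∈ K → v ∈ Λ' δ') ∧
                  Tendsto (fun δ' : ℝ => (δ' : ℂ) * hexMidpoint (a' δ')) (𝓝[>] 0) (𝓝 (M.pt 0)) ∧
                  Tendsto (fun δ' : ℝ => (δ' : ℂ) * hexMidpoint (b' δ')) (𝓝[>] 0) (𝓝 (M.pt 1)) ∧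
                  Tendsto (fun j : ℕ => ((δ (φ (ψ j)) : ℝ) : ℂ) *
                    Literature.Probability.LatticeModels.triEmbed (x j)) atTop (𝓝 τ) ∧
                  (∀ j : ℕ,
                    (∀ w : HexVertex, w ∈ Λ'' j ↔ ((-(x j) + w.1, w.2) : HexVertex) ∈ Λ' (δ (φ (ψ j)))) ∧
                    (∀ w ∈ Λ'' j, w ∉ S (φ (ψ j)) (n (φ (ψ j))) ∪ T (φ (ψ j)) (n' (φ (ψ j)))) ∧
                    (∀ w ∈ Λ'' j, ∀ y ∈ Λ'' j, hexGraph.Adj w y →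
                      (hexDomainGraph D.carrier (δ (φ (ψ j)))).Adj w y) ∧
                    q (φ (ψ j)) ∈ Λ'' j ∧
                    pu j ∈ S (φ (ψ j)) (n (φ (ψ j))) ∪ T (φ (ψ j)) (n' (φ (ψ j))) ∧
                    pv j ∈ S (φ (ψ j)) (n (φ (ψ j))) ∪ T (φ (ψ j)) (n' (φ (ψ j))) ∧
                    hexGraph.Adj (q (φ (ψ j))) (pu j) ∧
                    s(q (φ (ψ j)), pu j) ≠ s(q' (φ (ψ j)), pv j) ∧
                    (a' (δ (φ (ψ j)))).map (fun w : HexVertex => ((x j + w.1, w.2) : HexVertex)) =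
                      s(q (φ (ψ j)), pu j) ∧
                    (b' (δ (φ (ψ j)))).map (fun w : HexVertex => ((x j + w.1, w.2) : HexVertex)) =
                      s(q' (φ (ψ j)), pv j)) ∧
                  (∀ᶠ j : ℕ in atTop, 1 - ε' ≤
                    (carvedLaw D.carrier (δ (φ (ψ j))) (S (φ (ψ j)) (n (φ (ψ j))) ∪ T (φ (ψ j)) (n' (φ (ψ j))))
                      (q (φ (ψ j))) (q' (φ (ψ j))) {ξ | ∀ w ∈ ξ.walk.support, w ∈ Λ'' j}).toReal))) :
    ObservableToSLER := by
  intro hO hT D₀ a₀ b₀ hab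
  -- the family constraint of r11 (fat co-oriented solid), as a term
  let P : DobrushinDomain → (ℝ → HexVertex) → (ℝ → HexVertex) → ℝ → ℝ → ℝ → ℕ →
      (ℕ → Set HexVertex) → (ℕ → Set HexVertex) → Prop :=
    fun D a b δ ρ _R _N S T =>
      (∀ n, ExteriorAnchored D.carrier δ (S n) (a δ)) ∧
        (∀ n, ExteriorAnchored D.carrier δ (T n) (b δ)) ∧
        ∃ j : Fin 6,
          ((∀ (n : ℕ) (p q : HexVertex), HasCleanWindow D.carrier δ ρ (S n) p q →
              rowOf j q = rowOf j p + 1 ∧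
                ∀ x : HexVertex, (δ : ℂ) * hexCenter x ∈ ball ((δ : ℂ) * hexCenter q) ρ →
                  (x ∈ S n ↔ rowOf j x ≤ rowOf j p)) ∧
            (∀ (n : ℕ) (p q : HexVertex), HasCleanWindow D.carrier δ ρ (T n) p q →
              rowOf j q = rowOf j p + 1 ∧
                ∀ x : HexVertex, (δ : ℂ) * hexCenter x ∈ ball ((δ : ℂ) * hexCenter q) ρ →
                  (x ∈ T n ↔ rowOf j x ≤ rowOf j p))) ∧
          (∀ (n : ℕ) (p q : HexVertex), HasCleanWindow D.carrier δ ρ (S n) p q →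
            ∃ K : Set ℂ, IsCompact K ∧ IsConnected K ∧
              (δ : ℂ) * hexCenter q - ((ρ / 2 : ℝ) : ℂ) * Complex.I * triZeta ^ (j : ℕ) ∈ K ∧
              (δ : ℂ) * hexCenter (a δ) ∈ K ∧
              ∀ v : HexVertex, Metric.infDist ((δ : ℂ) * hexCenter v) K ≤ ρ / 4 → v ∈ S n) ∧
          (∀ (n : ℕ) (p q : HexVertex), HasCleanWindow D.carrier δ ρ (T n) p q →
            ∃ K : Set ℂ, IsCompact K ∧ IsConnected K ∧
              (δ : ℂ) * hexCenter q - ((ρ / 2 : ℝ) : ℂ) * Complex.I * triZeta ^ (j : ℕ) ∈ K ∧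
              (δ : ℂ) * hexCenter (b δ) ∈ K ∧
              ∀ v : HexVertex, Metric.infDist ((δ : ℂ) * hexCenter v) K ≤ ρ / 4 → v ∈ T n) ∧
          (∀ i : ℕ, ∃ K : Set ℂ, IsCompact K ∧ IsConnected K ∧ (δ : ℂ) * hexCenter (a δ) ∈ K ∧
            (∀ v : HexVertex, Metric.infDist ((δ : ℂ) * hexCenter v) K ≤ ρ / 8 → v ∈ S i) ∧
            (∀ v ∈ S i, ∃ (t w : HexVertex) (r : ℕ), v ∈ hexBall t r ∧ w ∈ hexBall t r ∧
              hexBall t r ⊆ S i ∧ Metric.infDist ((δ : ℂ) * hexCenter w) K ≤ ρ / 16)) ∧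
          (∀ i : ℕ, ∃ K : Set ℂ, IsCompact K ∧ IsConnected K ∧ (δ : ℂ) * hexCenter (b δ) ∈ K ∧
            (∀ v : HexVertex, Metric.infDist ((δ : ℂ) * hexCenter v) K ≤ ρ / 8 → v ∈ T i) ∧
            (∀ v ∈ T i, ∃ (t w : HexVertex) (r : ℕ), v ∈ hexBall t r ∧ w ∈ hexBall t r ∧
              hexBall t r ⊆ T i ∧ Metric.infDist ((δ : ℂ) * hexCenter w) K ≤ ρ / 16))
  -- the class-zero solid family constraint (source class of the co-oriented reduction), as a term
  let P₀ : DobrushinDomain → (ℝ → HexVertex) → (ℝ → HexVertex) → ℝ → ℝ → ℝ → ℕ →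
      (ℕ → Set HexVertex) → (ℕ → Set HexVertex) → Prop :=
    fun D a b δ ρ _R _N S T =>
      ((∀ n, ExteriorAnchored D.carrier δ (S n) (a δ)) ∧
        (∀ n, ExteriorAnchored D.carrier δ (T n) (b δ)) ∧
        (∀ (n : ℕ) (p q : HexVertex), HasCleanWindow D.carrier δ ρ (S n) p q →
          rowOf 0 q = rowOf 0 p + 1 ∧
            ∀ x : HexVertex, (δ : ℂ) * hexCenter x ∈ ball ((δ : ℂ) * hexCenter q) ρ →
              (x ∈ S n ↔ rowOf 0 x ≤ rowOf 0 p)) ∧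
        (∀ (n : ℕ) (p q : HexVertex), HasCleanWindow D.carrier δ ρ (T n) p q →
          rowOf 0 q = rowOf 0 p + 1 ∧
            ∀ x : HexVertex, (δ : ℂ) * hexCenter x ∈ ball ((δ : ℂ) * hexCenter q) ρ →
              (x ∈ T n ↔ rowOf 0 x ≤ rowOf 0 p))) ∧
      (∀ (n : ℕ) (p q : HexVertex), HasCleanWindow D.carrier δ ρ (S n) p q →
        ∃ K : Set ℂ, IsCompact K ∧ IsConnected K ∧
          (δ : ℂ) * hexCenter q - ((ρ / 2 : ℝ) : ℂ) * Complex.I ∈ K ∧ (δ : ℂ) * hexCenter (a δ) ∈ K ∧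
          ∀ v : HexVertex, Metric.infDist ((δ : ℂ) * hexCenter v) K ≤ ρ / 4 → v ∈ S n) ∧
      (∀ (n : ℕ) (p q : HexVertex), HasCleanWindow D.carrier δ ρ (T n) p q →
        ∃ K : Set ℂ, IsCompact K ∧ IsConnected K ∧
          (δ : ℂ) * hexCenter q - ((ρ / 2 : ℝ) : ℂ) * Complex.I ∈ K ∧ (δ : ℂ) * hexCenter (b δ) ∈ K ∧
          ∀ v : HexVertex, Metric.infDist ((δ : ℂ) * hexCenter v) K ≤ ρ / 4 → v ∈ T n) ∧
      (∀ i : ℕ, ∃ K : Set ℂ, IsCompact K ∧ IsConnected K ∧ (δ : ℂ) * hexCenter (a δ) ∈ K ∧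
        (∀ v : HexVertex, Metric.infDist ((δ : ℂ) * hexCenter v) K ≤ ρ / 8 → v ∈ S i) ∧
        (∀ v ∈ S i, ∃ (t w : HexVertex) (r : ℕ), v ∈ hexBall t r ∧ w ∈ hexBall t r ∧
          hexBall t r ⊆ S i ∧ Metric.infDist ((δ : ℂ) * hexCenter w) K ≤ ρ / 16)) ∧
      (∀ i : ℕ, ∃ K : Set ℂ, IsCompact K ∧ IsConnected K ∧ (δ : ℂ) * hexCenter (b δ) ∈ K ∧
        (∀ v : HexVertex, Metric.infDist ((δ : ℂ) * hexCenter v) K ≤ ρ / 8 → v ∈ T i) ∧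
        (∀ v ∈ T i, ∃ (t w : HexVertex) (r : ℕ), v ∈ hexBall t r ∧ w ∈ hexBall t r ∧
          hexBall t r ⊆ T i ∧ Metric.infDist ((δ : ℂ) * hexCenter w) K ≤ ρ / 16))
  -- ARL″ from `R` and the anchor (p121515)
  have hARL :=
    Summit.CriticalPhenomena.SAWScalingLimit.Theorems.ObservableToSLER.TwoPiece.stub_twoPieceAdmRestrictionLimit hO h5a1
  -- class-(0,0) solid CSI: squeeze (hypothesis) + T2a (p126992) + generic assembly (p130700) + Radó continuity (p81676)
  have hCSI₀ :=
    Summit.CriticalPhenomena.SAWScalingLimit.Theorems.ObservableToSLE.TypeLadder.stub_carvedReduction_assemblyP P₀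
      (hSq hARL)
      (Summit.CriticalPhenomena.SAWScalingLimit.Theorems.ObservableToSLE.TypeLadder.stub_twoPieceAdmIdentification hARL)
      stub_sleLawContinuity
  -- co-oriented solid CSI (p134331)
  have hCSI :=
    Summit.CriticalPhenomena.SAWScalingLimit.Theorems.ObservableToSLER.CoOrientedSolid.stub_coOrientedReductionSolid hCSI₀
  -- modulus (p127640) and the sequential reduction (p120538) with averaged tightness (p116996) / modulus (p120791)
  have hMod := stub_residueSolid_modulus hT h7148
  have hCarved := stub_seqReductionPM P hCSI (stub_midTightN hT) (stub_midModulusN hMod)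
  -- the R-bounded nested transfer (p124665) and the identification criterion
  have hfull :=
    Summit.CriticalPhenomena.SAWScalingLimit.Theorems.ObservableToSLE.TypeLadder.stub_nestedTransferPR P
      stub_gateDecomposition h2 hCarved
  exact Summit.CriticalPhenomena.SAWScalingLimit.Theorems.ObservableToSLE.Negative.convergesInLawToSLE_of_identification
    hab (hT D₀ a₀ b₀ hab) (hfull D₀ a₀ b₀ hab)

end Summit.CriticalPhenomena.SAWScalingLimit.Theorems.ObservableToSLER.Residue

end
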